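import Summits.QuantumAdvantage.QuantumAdvantage.Theorems.SosSandwichTransferPBPerFamily
import Summits.QuantumAdvantage.QuantumAdvantage.Theorems.SosSandwichTransferPBPathBoundChainFinal
import Summits.QuantumAdvantage.QuantumAdvantage.Theorems.SosSandwichQueryAAQCalibration
import HarnessLib

/-!
# `TransferPB`'s machine reduction PER FAMILY — the path-wise bound demanded only for ONE oracle family, part 2 (levels 5–9 and the consequences)

Route `SosSandwich`, support for cruxes `PseudoBoundedAA` (stmt-QuantumAdvantage-15237) / `RandomOracleHeurSeparation` (stmt-1131).
The tree's re-threaded machine chain (`…PathBoundChain*.lean`: `AApath → OracleSimulation`) takes ONE global pair of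
constants `(c, C₀)` for all uniform Clifford+T oracle families, but its proof uses the influence bound only at the family
being simulated (`OracleSimulation` is a per-family existential).  This file and its sequel restate the nine levels with

* the conclusion `OracleSimulation` replaced by its body AT A FIXED FAMILY `F₀` (written out; no new definition), and
* the hypothesis `AApath` replaced by `AApath_{F₀} := ∃ c C₀ > 0, ∀ x ρ ε, 0 < ε ≤ Var[p_x|_ρ] → ∃ i, C₀ (ε/thm23Degree F₀ x)^c ≤ Inf_i`
  (constants may depend on the family),

proofs VERBATIM (root: `intro F` dropped).  Purpose (sequel, `…PerFamilyFinal`): families with BOUNDEDLY MANY oracle gates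
satisfy `AApath_{F₀}` UNCONDITIONALLY (DFKO via `QueryPathBridge.pathBound_expLoss`), so they enjoy Aaronson–Ambainis' promise-oracle
simulation with no conjecture at all — the `O(1)`-query case of AA14 Thm. 26 in the tree's promise-transfer form; and the
global chain is the special case of constant constants.  Honest label: re-threading; nothing new about machines.
Sources: AaronsonAmbainis2014 Thm. 21, Thm. 23 (proof, p. 14), Thm. 26; BennettBernsteinBrassardVazirani1997; Zhandry2012.
-/

-- D-0017: single-conjunct summit ⇒ the duplicate `QuantumAdvantage.QuantumAdvantage` is mandated.
set_option linter.dupNamespace false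

noncomputable section

namespace Summit.QuantumAdvantage.QuantumAdvantage.Cruxes.TransferPB.Birth

open Finset MeasureTheory Literature.Computability.Cryptography Literature.Computability.Complexity
  Literature.Computability.QuantumComplexity Literature.Computability.QuantumComplexity.ClassicalSimulation
open Summit.QuantumAdvantage.QuantumAdvantage.Theses.SosSandwich
open scoped ENNReal

namespace SimTreePB
/-- **Node-problem level, path-wise bound** (twin of `stub_pbOracleSimulation_of_nodeProblem_consistent`, per-family form, proof verbatim). [cite: AaronsonAmbainis2014, Thm. 23 (proof, p. 14)] -/
theorem oracleSimulationAt_of_nodeProblem_consistent_path (F₀ : QCircuitFamily cliffordT)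
    (hQ : ∀ (c k : ℕ) (F : QCircuitFamily cliffordT), F.IsUniform → ∀ r : Polynomial ℕ,
      nodeProblem F r c k ∈ Literature.Computability.Cryptography.PromiseBQP)
    (hM : ∀ (c k : ℕ) (F : QCircuitFamily cliffordT), F.IsUniform → ∀ r : Polynomial ℕ,
      ∃ (C : OracleAlg Bool) (q : Polynomial ℕ),
        C.IsPolyTime Computability.encodingBoolBool ∧
        (∀ (O : Oracle) (x : List Bool), ∀ y ∈ C.queries O (q.eval x.length) x, y.length ≤ q.eval x.length) ∧
        ∀ x : List Bool, 1 ≤ x.length → ∀ g : List Bool → Bool,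
          (∀ v ∈ (nodeProblem F r c k).yes, g v = true) → (∀ v ∈ (nodeProblem F r c k).no, g v = false) →
          ∃ D : ℕ, machineBudget F x r c k ≤ D ∧
            ∀ A : Set (List Bool),
              C.run (Oracle.ofLanguage {w : List Bool | ∃ v : List Bool,
                  (w = false :: v ∧ v ∈ A) ∨ (w = true :: v ∧ g v = true)}) (q.eval x.length) x =
                some (decide (1 / 2 ≤
                  (advTree (derivedAdvisor F x g) D []).eval (oracleBits F x A)))) :
    (∃ (c : ℕ) (C₀ : ℝ), 0 < C₀ ∧ ∀ (x : List Bool)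
      (ρ : List (Fin (numOracleBits F₀ x) × Bool)) (ε : ℝ), 0 < ε →
      ε ≤ boolVariance (restrictPath ρ (acceptPoly F₀ x)) →
        ∃ i : Fin (numOracleBits F₀ x),
          C₀ * (ε / thm23Degree F₀ x) ^ c ≤ influence i (restrictPath ρ (acceptPoly F₀ x))) →
      F₀.IsUniform → ∀ r : Polynomial ℕ,
        ∃ Q ∈ Literature.Computability.Cryptography.PromiseBQP, ∃ (C : OracleAlg Bool) (q : Polynomial ℕ),
          C.IsPolyTime Computability.encodingBoolBool ∧
          (∀ (O : Oracle) (x : List Bool), ∀ y ∈ C.queries O (q.eval x.length) x, y.length ≤ q.eval x.length) ∧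
          ∀ x : List Bool, 1 ≤ x.length → ∀ g : List Bool → Bool,
            (∀ v ∈ Q.yes, g v = true) → (∀ v ∈ Q.no, g v = false) →
            (ProbabilityTheory.setBernoulli (Set.univ : Set (List Bool)) ⟨1 / 2, by norm_num, by norm_num⟩)
              {A : Set (List Bool) |
                (2 / 3 ≤ F₀.acceptProbOn A x ∧
                  C.run (Oracle.ofLanguage {w : List Bool | ∃ v : List Bool, (w = false :: v ∧ v ∈ A) ∨
                    (w = true :: v ∧ g v = true)}) (q.eval x.length) x ≠ some true) ∨
                (F₀.acceptProbOn A x ≤ 1 / 3 ∧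
                  C.run (Oracle.ofLanguage {w : List Bool | ∃ v : List Bool, (w = false :: v ∧ v ∈ A) ∨
                    (w = true :: v ∧ g v = true)}) (q.eval x.length) x ≠ some false)}
              ≤ ENNReal.ofReal (1 / (((r.eval x.length : ℕ) : ℝ) + 1)) := by
  refine oracleSimulationAt_of_keptMachines_path F₀ hQ fun c k F hF r => ?_
  obtain ⟨C, q, hCpoly, hCq, hrun⟩ := hM c k F hF r
  refine ⟨C, q, hCpoly, hCq, fun x hx g hgy hgn => ?_⟩
  obtain ⟨D, hD, hrunA⟩ := hrun x hx g hgy hgn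
  exact ⟨derivedAdvisor F x g, D, hD, fun ρ s h => derivedAdvisor_pick_some_kept h,
    fun ρ h => derivedAdvisor_pick_none_kept h, derivedAdvisor_val_eq, hrunA⟩



/-- **Descent-machine level, path-wise bound** (twin of `stub_pbOracleSimulation_of_descentMachines`, per-family form, proof verbatim). [cite: AaronsonAmbainis2014, Thm. 23 (proof, p. 14)] -/
theorem oracleSimulationAt_of_descentMachines_path (F₀ : QCircuitFamily cliffordT)
    (hQ : ∀ (c k : ℕ) (F : QCircuitFamily cliffordT), F.IsUniform → ∀ r : Polynomial ℕ,
      nodeProblem F r c k ∈ Literature.Computability.Cryptography.PromiseBQP)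
    (hM : ∀ (c k : ℕ) (F : QCircuitFamily cliffordT), F.IsUniform → ∀ r : Polynomial ℕ,
      ∃ (C : OracleAlg Bool) (q : Polynomial ℕ),
        C.IsPolyTime Computability.encodingBoolBool ∧
        (∀ (O : Oracle) (x : List Bool), ∀ y ∈ C.queries O (q.eval x.length) x, y.length ≤ q.eval x.length) ∧
        ∀ x : List Bool, 1 ≤ x.length → ∀ g : List Bool → Bool,
          (∀ v ∈ (nodeProblem F r c k).yes, g v = true) → (∀ v ∈ (nodeProblem F r c k).no, g v = false) →
          ∃ D : ℕ, machineBudget F x r c k ≤ D ∧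
            ∀ A : Set (List Bool),
              C.run (Oracle.ofLanguage {w : List Bool | ∃ v : List Bool,
                  (w = false :: v ∧ v ∈ A) ∨ (w = true :: v ∧ g v = true)}) (q.eval x.length) x =
                some (decide (1 / 2 ≤
                  (advTree (descentAdvisor F x g) D []).eval (oracleBits F x A)))) :
    (∃ (c : ℕ) (C₀ : ℝ), 0 < C₀ ∧ ∀ (x : List Bool)
      (ρ : List (Fin (numOracleBits F₀ x) × Bool)) (ε : ℝ), 0 < ε →
      ε ≤ boolVariance (restrictPath ρ (acceptPoly F₀ x)) →
        ∃ i : Fin (numOracleBits F₀ x),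
          C₀ * (ε / thm23Degree F₀ x) ^ c ≤ influence i (restrictPath ρ (acceptPoly F₀ x))) →
      F₀.IsUniform → ∀ r : Polynomial ℕ,
        ∃ Q ∈ Literature.Computability.Cryptography.PromiseBQP, ∃ (C : OracleAlg Bool) (q : Polynomial ℕ),
          C.IsPolyTime Computability.encodingBoolBool ∧
          (∀ (O : Oracle) (x : List Bool), ∀ y ∈ C.queries O (q.eval x.length) x, y.length ≤ q.eval x.length) ∧
          ∀ x : List Bool, 1 ≤ x.length → ∀ g : List Bool → Bool,
            (∀ v ∈ Q.yes, g v = true) → (∀ v ∈ Q.no, g v = false) →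
            (ProbabilityTheory.setBernoulli (Set.univ : Set (List Bool)) ⟨1 / 2, by norm_num, by norm_num⟩)
              {A : Set (List Bool) |
                (2 / 3 ≤ F₀.acceptProbOn A x ∧
                  C.run (Oracle.ofLanguage {w : List Bool | ∃ v : List Bool, (w = false :: v ∧ v ∈ A) ∨
                    (w = true :: v ∧ g v = true)}) (q.eval x.length) x ≠ some true) ∨
                (F₀.acceptProbOn A x ≤ 1 / 3 ∧
                  C.run (Oracle.ofLanguage {w : List Bool | ∃ v : List Bool, (w = false :: v ∧ v ∈ A) ∨
                    (w = true :: v ∧ g v = true)}) (q.eval x.length) x ≠ some false)}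
              ≤ ENNReal.ofReal (1 / (((r.eval x.length : ℕ) : ℝ) + 1)) := by
  refine oracleSimulationAt_of_keptMachines_path F₀ hQ fun c k F hF r => ?_
  obtain ⟨C, q, hCpoly, hCq, hrun⟩ := hM c k F hF r
  refine ⟨C, q, hCpoly, hCq, fun x hx g hgy hgn => ?_⟩
  obtain ⟨D, hD, hrunA⟩ := hrun x hx g hgy hgn
  exact ⟨descentAdvisor F x g, D, hD, fun ρ s h => descentAdvisor_pick_some h,
    fun ρ h => descentAdvisor_pick_none h, descentAdvisor_val_eq, hrunA⟩

/-- **String-machine level, path-wise bound** (twin of `stub_pbOracleSimulation_of_stringMachines`, per-family form, proof verbatim). [cite: AaronsonAmbainis2014, Thm. 23 (proof, p. 14)] -/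
theorem oracleSimulationAt_of_stringMachines_path (F₀ : QCircuitFamily cliffordT)
    (hQ : ∀ (c k : ℕ) (F : QCircuitFamily cliffordT), F.IsUniform → ∀ r : Polynomial ℕ,
      nodeProblem F r c k ∈ Literature.Computability.Cryptography.PromiseBQP)
    (hM : ∀ (c k : ℕ) (F : QCircuitFamily cliffordT), F.IsUniform → ∀ r : Polynomial ℕ,
      ∃ (C : OracleAlg Bool) (q : Polynomial ℕ),
        C.IsPolyTime Computability.encodingBoolBool ∧
        (∀ (O : Oracle) (x : List Bool), ∀ y ∈ C.queries O (q.eval x.length) x, y.length ≤ q.eval x.length) ∧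
        ∀ x : List Bool, 1 ≤ x.length → ∀ g : List Bool → Bool,
          (∀ v ∈ (nodeProblem F r c k).yes, g v = true) → (∀ v ∈ (nodeProblem F r c k).no, g v = false) →
          ∃ (W' D : ℕ), oracleWidth F x ≤ W' ∧ machineBudget F x r c k ≤ D ∧
            ∀ A : Set (List Bool),
              C.run (Oracle.ofLanguage {w : List Bool | ∃ v : List Bool,
                  (w = false :: v ∧ v ∈ A) ∨ (w = true :: v ∧ g v = true)}) (q.eval x.length) x =
                some (decide (20 ≤ meanCount g x (strWalk g x W' (fun u => A.boolIndicator u) D [])))) :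
    (∃ (c : ℕ) (C₀ : ℝ), 0 < C₀ ∧ ∀ (x : List Bool)
      (ρ : List (Fin (numOracleBits F₀ x) × Bool)) (ε : ℝ), 0 < ε →
      ε ≤ boolVariance (restrictPath ρ (acceptPoly F₀ x)) →
        ∃ i : Fin (numOracleBits F₀ x),
          C₀ * (ε / thm23Degree F₀ x) ^ c ≤ influence i (restrictPath ρ (acceptPoly F₀ x))) →
      F₀.IsUniform → ∀ r : Polynomial ℕ,
        ∃ Q ∈ Literature.Computability.Cryptography.PromiseBQP, ∃ (C : OracleAlg Bool) (q : Polynomial ℕ),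
          C.IsPolyTime Computability.encodingBoolBool ∧
          (∀ (O : Oracle) (x : List Bool), ∀ y ∈ C.queries O (q.eval x.length) x, y.length ≤ q.eval x.length) ∧
          ∀ x : List Bool, 1 ≤ x.length → ∀ g : List Bool → Bool,
            (∀ v ∈ Q.yes, g v = true) → (∀ v ∈ Q.no, g v = false) →
            (ProbabilityTheory.setBernoulli (Set.univ : Set (List Bool)) ⟨1 / 2, by norm_num, by norm_num⟩)
              {A : Set (List Bool) |
                (2 / 3 ≤ F₀.acceptProbOn A x ∧
                  C.run (Oracle.ofLanguage {w : List Bool | ∃ v : List Bool, (w = false :: v ∧ v ∈ A) ∨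
                    (w = true :: v ∧ g v = true)}) (q.eval x.length) x ≠ some true) ∨
                (F₀.acceptProbOn A x ≤ 1 / 3 ∧
                  C.run (Oracle.ofLanguage {w : List Bool | ∃ v : List Bool, (w = false :: v ∧ v ∈ A) ∨
                    (w = true :: v ∧ g v = true)}) (q.eval x.length) x ≠ some false)}
              ≤ ENNReal.ofReal (1 / (((r.eval x.length : ℕ) : ℝ) + 1)) := by
  refine oracleSimulationAt_of_descentMachines_path F₀ hQ fun c k F hF r => ?_
  obtain ⟨C, q, hCpoly, hCq, hrun⟩ := hM c k F hF r
  refine ⟨C, q, hCpoly, hCq, fun x hx g hgy hgn => ?_⟩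
  obtain ⟨W', D, hW, hD, hrunA⟩ := hrun x hx g hgy hgn
  refine ⟨D, hD, fun A => ?_⟩
  rw [hrunA A, decide_eval_advTree_descentAdvisor, ← strPath_nil F x,
    strWalk_eq_of_le hgn (fun u => A.boolIndicator u) hW D []]

/-- **Event-machine level, path-wise bound** (twin of `stub_pbOracleSimulation_of_eventOSM`, per-family form, proof verbatim). [cite: AaronsonAmbainis2014, Thm. 23 (proof, p. 14)] -/
theorem oracleSimulationAt_of_eventOSM_path (F₀ : QCircuitFamily cliffordT)
    (hQ : ∀ (c k : ℕ) (F : QCircuitFamily cliffordT), F.IsUniform → ∀ r : Polynomial ℕ,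
      nodeProblem F r c k ∈ Literature.Computability.Cryptography.PromiseBQP)
    (hE : ∀ pw pd : Polynomial ℕ, ∃ (S : OSM) (enc : List Bool → EvState → List Bool) (G : Polynomial ℕ),
      S.ini ∈ FP ∧ S.del ∈ FP ∧ S.kap ∈ FP ∧
      (∀ (x st : List Bool) (b : Bool), (S.del (boolPair x (boolPair st [b]))).length ≤ st.length + G.eval x.length) ∧
      (∀ x : List Bool, S.ini x = enc x (evInit (pd.eval x.length))) ∧
      (∀ (x : List Bool) (s : EvState) (b : Bool), EvInv (pw.eval x.length) (pd.eval x.length) s →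
        S.del (boolPair x (boolPair (enc x s) [b])) = enc x (evDelta (pw.eval x.length) s b)) ∧
      (∀ (x : List Bool) (s : EvState), EvInv (pw.eval x.length) (pd.eval x.length) s →
        S.kap (boolPair x (enc x s)) = Sum.elim (fun q => false :: q) (fun b => [true, b]) (evKappa x s))) :
    (∃ (c : ℕ) (C₀ : ℝ), 0 < C₀ ∧ ∀ (x : List Bool)
      (ρ : List (Fin (numOracleBits F₀ x) × Bool)) (ε : ℝ), 0 < ε →
      ε ≤ boolVariance (restrictPath ρ (acceptPoly F₀ x)) →
        ∃ i : Fin (numOracleBits F₀ x),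
          C₀ * (ε / thm23Degree F₀ x) ^ c ≤ influence i (restrictPath ρ (acceptPoly F₀ x))) →
      F₀.IsUniform → ∀ r : Polynomial ℕ,
        ∃ Q ∈ Literature.Computability.Cryptography.PromiseBQP, ∃ (C : OracleAlg Bool) (q : Polynomial ℕ),
          C.IsPolyTime Computability.encodingBoolBool ∧
          (∀ (O : Oracle) (x : List Bool), ∀ y ∈ C.queries O (q.eval x.length) x, y.length ≤ q.eval x.length) ∧
          ∀ x : List Bool, 1 ≤ x.length → ∀ g : List Bool → Bool,
            (∀ v ∈ Q.yes, g v = true) → (∀ v ∈ Q.no, g v = false) →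
            (ProbabilityTheory.setBernoulli (Set.univ : Set (List Bool)) ⟨1 / 2, by norm_num, by norm_num⟩)
              {A : Set (List Bool) |
                (2 / 3 ≤ F₀.acceptProbOn A x ∧
                  C.run (Oracle.ofLanguage {w : List Bool | ∃ v : List Bool, (w = false :: v ∧ v ∈ A) ∨
                    (w = true :: v ∧ g v = true)}) (q.eval x.length) x ≠ some true) ∨
                (F₀.acceptProbOn A x ≤ 1 / 3 ∧
                  C.run (Oracle.ofLanguage {w : List Bool | ∃ v : List Bool, (w = false :: v ∧ v ∈ A) ∨
                    (w = true :: v ∧ g v = true)}) (q.eval x.length) x ≠ some false)}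
              ≤ ENNReal.ofReal (1 / (((r.eval x.length : ℕ) : ℝ) + 1)) := by
  refine oracleSimulationAt_of_stringMachines_path F₀ hQ fun c k F hF r => ?_
  obtain ⟨s, hs⟩ := QCircuitFamily.IsUniform.isPolySize' hF
  let Lp : Polynomial ℕ :=
    Polynomial.C 8 * s ^ 2 * Polynomial.C (2 ^ k) * (Polynomial.C 400 * (Polynomial.C 2 * s + 1) * (r + 1)) ^ c
  let pw : Polynomial ℕ := Polynomial.X + s
  let pd : Polynomial ℕ := Polynomial.C 2 * Lp * (r + 1) + 1
  have hLp : ∀ n : ℕ, Lp.eval n = 8 * (s.eval n) ^ 2 * 2 ^ k * (400 * (2 * s.eval n + 1) * (r.eval n + 1)) ^ c := by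
    intro n; simp [Lp]
  have hpw : ∀ n : ℕ, pw.eval n = n + s.eval n := by intro n; simp [pw]
  have hpd : ∀ n : ℕ, pd.eval n = 2 * Lp.eval n * (r.eval n + 1) + 1 := by intro n; simp [pd]
  obtain ⟨S, enc, G, hiniFP, hdelFP, hkapFP, hG, hini, hdel, hkap⟩ := hE pw pd
  let q : Polynomial ℕ :=
    pd * (Polynomial.C 3 * (pw * Lp) + Polynomial.C 2) + Polynomial.C 41 +
      (Polynomial.C 2 * Polynomial.X + Polynomial.C 2 * pd * (Polynomial.C 2 * pw + Polynomial.C 4) + pw + Polynomial.C 50)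
  have hq : ∀ n : ℕ, q.eval n = pd.eval n * (3 * (pw.eval n * Lp.eval n) + 2) + 41 +
      (2 * n + 2 * pd.eval n * (2 * pw.eval n + 4) + pw.eval n + 50) := by
    intro n; simp [q]
  refine ⟨S.alg.mapOut Computability.decodeBool, q,
    isPolyTime_mapOut_decodeBool (S.isPolyTime_alg hiniFP hdelFP hkapFP hG), fun O x y hy => ?_,
    fun x _ g _ hgn => ?_⟩
  · -- query lengths
    have h := length_le_of_mem_queries_osm_mapOut (hini x) (hdel x) (hkap x) O _ hy
    unfold evQueryBound at h
    rw [hq]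
    omega
  · -- runs within the round budget
    have hW : oracleWidth F x ≤ pw.eval x.length := by
      show x.length + F.ancillas x.length ≤ pw.eval x.length
      rw [hpw]
      exact Nat.add_le_add_left (hs x.length).2 _
    have hT : (F.circ x.length).oracleQueries ≤ s.eval x.length :=
      (QCircuit.oracleQueries_le_size _).trans (hs x.length).1
    have hBL : 8 * (F.circ x.length).oracleQueries ^ 2 * 2 ^ k * (400 * thm23Degree F x * (r.eval x.length + 1)) ^ c ≤
        Lp.eval x.length := by
      rw [hLp]; exact liveBoundNat_mono (r := r) (c := c) (k := k) hT
    have hD : machineBudget F x r c k ≤ pd.eval x.length := by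
      rw [machineBudget_eq_nat, hpd]
      gcongr
    refine ⟨pw.eval x.length, pd.eval x.length, hW, hD, fun A => ?_⟩
    rw [run_osm_mapOut (hini x) (hdel x) (hkap x)]
    obtain ⟨m, hm, hrun⟩ := evLoop_evInit x (pw.eval x.length)
      (O := fun q' => Set.boolIndicator {w : List Bool | ∃ v : List Bool,
        (w = false :: v ∧ v ∈ A) ∨ (w = true :: v ∧ g v = true)} q')
      (g := g) (inA := fun u => A.boolIndicator u)
      (boolIndicator_combined_true A g) (boolIndicator_combined_false A g)
      (fun π => ∃ ρ : List (Fin (numOracleBits F x) × Bool), π = strPath F x ρ) ⟨[], (strPath_nil F x).symm⟩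
      (fun π hπ j => by obtain ⟨ρ, rfl⟩ := hπ; exact length_liveLevel_strPath_le hgn ρ j)
      (fun π hπ u hu => by
        obtain ⟨ρ, rfl⟩ := hπ
        obtain ⟨ρ', h⟩ := strPath_step_descentPick hgn hW ρ hu (A.boolIndicator u)
        exact ⟨ρ', h⟩) (pd.eval x.length)
    refine hrun _ (hm.trans ?_)
    have h2 : pd.eval x.length * (3 * (pw.eval x.length * (8 * (F.circ x.length).oracleQueries ^ 2 * 2 ^ k *
        (400 * thm23Degree F x * (r.eval x.length + 1)) ^ c)) + 2) ≤
        pd.eval x.length * (3 * (pw.eval x.length * Lp.eval x.length) + 2) := by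
      gcongr
    rw [hq]
    omega

/-- **The event-driven chain, path-wise bound** (twin of `EvOSM.stub_pbOracleSimulation_of_Q`): `OracleSimulation` from
(Q) `nodeProblem ∈ PromiseBQP` and `AApath`. [cite: AaronsonAmbainis2014, Thm. 23 (proof, p. 14)] -/
theorem oracleSimulationAt_of_Q_path (F₀ : QCircuitFamily cliffordT)
    (hQ : ∀ (c k : ℕ) (F : QCircuitFamily cliffordT), F.IsUniform → ∀ r : Polynomial ℕ,
      nodeProblem F r c k ∈ Literature.Computability.Cryptography.PromiseBQP) :
    (∃ (c : ℕ) (C₀ : ℝ), 0 < C₀ ∧ ∀ (x : List Bool)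
      (ρ : List (Fin (numOracleBits F₀ x) × Bool)) (ε : ℝ), 0 < ε →
      ε ≤ boolVariance (restrictPath ρ (acceptPoly F₀ x)) →
        ∃ i : Fin (numOracleBits F₀ x),
          C₀ * (ε / thm23Degree F₀ x) ^ c ≤ influence i (restrictPath ρ (acceptPoly F₀ x))) →
      F₀.IsUniform → ∀ r : Polynomial ℕ,
        ∃ Q ∈ Literature.Computability.Cryptography.PromiseBQP, ∃ (C : OracleAlg Bool) (q : Polynomial ℕ),
          C.IsPolyTime Computability.encodingBoolBool ∧
          (∀ (O : Oracle) (x : List Bool), ∀ y ∈ C.queries O (q.eval x.length) x, y.length ≤ q.eval x.length) ∧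
          ∀ x : List Bool, 1 ≤ x.length → ∀ g : List Bool → Bool,
            (∀ v ∈ Q.yes, g v = true) → (∀ v ∈ Q.no, g v = false) →
            (ProbabilityTheory.setBernoulli (Set.univ : Set (List Bool)) ⟨1 / 2, by norm_num, by norm_num⟩)
              {A : Set (List Bool) |
                (2 / 3 ≤ F₀.acceptProbOn A x ∧
                  C.run (Oracle.ofLanguage {w : List Bool | ∃ v : List Bool, (w = false :: v ∧ v ∈ A) ∨
                    (w = true :: v ∧ g v = true)}) (q.eval x.length) x ≠ some true) ∨
                (F₀.acceptProbOn A x ≤ 1 / 3 ∧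
                  C.run (Oracle.ofLanguage {w : List Bool | ∃ v : List Bool, (w = false :: v ∧ v ∈ A) ∨
                    (w = true :: v ∧ g v = true)}) (q.eval x.length) x ≠ some false)}
              ≤ ENNReal.ofReal (1 / (((r.eval x.length : ℕ) : ℝ) + 1)) :=
  oracleSimulationAt_of_eventOSM_path F₀ hQ EvOSM.eventOSM_spec


/-! ### Consequences: the per-family simulation, the global chain recovered, and the UNCONDITIONAL bounded-query case -/

/-- **Aaronson–Ambainis' promise-oracle simulation of ONE uniform family from ITS path-wise influence bound** (machine
halves discharged in the tree: `nodeProblem_mem_PromiseBQP`, `EvOSM.eventOSM_spec`). [cite: AaronsonAmbainis2014, Thm. 23 (proof, p. 14)] -/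
theorem oracleSimulationAt_of_pathBoundAt (F₀ : QCircuitFamily cliffordT)
    (hAA : ∃ (c : ℕ) (C₀ : ℝ), 0 < C₀ ∧ ∀ (x : List Bool)
      (ρ : List (Fin (numOracleBits F₀ x) × Bool)) (ε : ℝ), 0 < ε →
      ε ≤ boolVariance (restrictPath ρ (acceptPoly F₀ x)) →
        ∃ i : Fin (numOracleBits F₀ x),
          C₀ * (ε / thm23Degree F₀ x) ^ c ≤ influence i (restrictPath ρ (acceptPoly F₀ x))) :
    F₀.IsUniform → ∀ r : Polynomial ℕ,
        ∃ Q ∈ Literature.Computability.Cryptography.PromiseBQP, ∃ (C : OracleAlg Bool) (q : Polynomial ℕ),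
          C.IsPolyTime Computability.encodingBoolBool ∧
          (∀ (O : Oracle) (x : List Bool), ∀ y ∈ C.queries O (q.eval x.length) x, y.length ≤ q.eval x.length) ∧
          ∀ x : List Bool, 1 ≤ x.length → ∀ g : List Bool → Bool,
            (∀ v ∈ Q.yes, g v = true) → (∀ v ∈ Q.no, g v = false) →
            (ProbabilityTheory.setBernoulli (Set.univ : Set (List Bool)) ⟨1 / 2, by norm_num, by norm_num⟩)
              {A : Set (List Bool) |
                (2 / 3 ≤ F₀.acceptProbOn A x ∧
                  C.run (Oracle.ofLanguage {w : List Bool | ∃ v : List Bool, (w = false :: v ∧ v ∈ A) ∨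
                    (w = true :: v ∧ g v = true)}) (q.eval x.length) x ≠ some true) ∨
                (F₀.acceptProbOn A x ≤ 1 / 3 ∧
                  C.run (Oracle.ofLanguage {w : List Bool | ∃ v : List Bool, (w = false :: v ∧ v ∈ A) ∨
                    (w = true :: v ∧ g v = true)}) (q.eval x.length) x ≠ some false)}
              ≤ ENNReal.ofReal (1 / (((r.eval x.length : ℕ) : ℝ) + 1)) :=
  oracleSimulationAt_of_Q_path F₀ (fun c k _ hF r => nodeProblem_mem_PromiseBQP r c k hF) hAA

/-- **The global chain is the special case of family-independent constants**: `OracleSimulation` from a path-wise bound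
whose constants may depend on the (uniform) family. [cite: AaronsonAmbainis2014, Thm. 23 (proof, p. 14)] -/
theorem oracleSimulation_of_forall_pathBoundAt
    (h : ∀ F₀ : QCircuitFamily cliffordT, F₀.IsUniform → ∃ (c : ℕ) (C₀ : ℝ), 0 < C₀ ∧ ∀ (x : List Bool)
      (ρ : List (Fin (numOracleBits F₀ x) × Bool)) (ε : ℝ), 0 < ε →
      ε ≤ boolVariance (restrictPath ρ (acceptPoly F₀ x)) →
        ∃ i : Fin (numOracleBits F₀ x),
          C₀ * (ε / thm23Degree F₀ x) ^ c ≤ influence i (restrictPath ρ (acceptPoly F₀ x))) :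
    OracleSimulation := by
  intro F hF r
  exact oracleSimulationAt_of_pathBoundAt F (h F hF) hF r

/-- **Bounded-query families satisfy the per-family path-wise bound UNCONDITIONALLY**: if every circuit of `F₀` has at most
`T₀` oracle gates then `thm23Degree F₀ x ≤ 2T₀+1`, and the proved DFKO bound transported through the circuit→query bridge
(`QueryPathBridge.pathBound_expLoss`: `Inf_i ≥ ε^a / 2^{C·2·thm23Degree}`) gives `AApath_{F₀}` with
`(c, C₀) = (a, 2^{-2C(2T₀+1)})`. [cite: DinurEtAl2007, Thm. 3] [cite: AaronsonAmbainis2014, Thm. 26 and p. 6] -/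
theorem pathBoundAt_of_boundedQueries (T₀ : ℕ) (F₀ : QCircuitFamily cliffordT)
    (hT : ∀ n, (F₀.circ n).oracleQueries ≤ T₀) :
    ∃ (c : ℕ) (C₀ : ℝ), 0 < C₀ ∧ ∀ (x : List Bool)
      (ρ : List (Fin (numOracleBits F₀ x) × Bool)) (ε : ℝ), 0 < ε →
      ε ≤ boolVariance (restrictPath ρ (acceptPoly F₀ x)) →
        ∃ i : Fin (numOracleBits F₀ x),
          C₀ * (ε / thm23Degree F₀ x) ^ c ≤ influence i (restrictPath ρ (acceptPoly F₀ x)) := by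
  obtain ⟨a, C, H⟩ :=
    Summit.QuantumAdvantage.QuantumAdvantage.Theorems.SosSandwich.QueryPathBridge.pathBound_expLoss cliffordT_isUnitary_holds
  refine ⟨a, 1 / (2 : ℝ) ^ (C * (2 * (2 * T₀ + 1))), by positivity, fun x ρ ε hε hv => ?_⟩
  obtain ⟨i, hi⟩ := H F₀ x ρ ε hε hv
  refine ⟨i, le_trans ?_ hi⟩
  have hd1 : (1 : ℝ) ≤ thm23Degree F₀ x := by
    exact_mod_cast (show 1 ≤ thm23Degree F₀ x by unfold thm23Degree; omega)
  have hdT : thm23Degree F₀ x ≤ 2 * T₀ + 1 := by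
    have := hT x.length
    unfold thm23Degree
    omega
  have hεd : (ε / thm23Degree F₀ x) ^ a ≤ ε ^ a :=
    pow_le_pow_left₀ (div_nonneg hε.le (by positivity)) (div_le_self hε.le hd1) a
  have hpow : (2 : ℝ) ^ (C * (2 * thm23Degree F₀ x)) ≤ (2 : ℝ) ^ (C * (2 * (2 * T₀ + 1))) :=
    pow_le_pow_right₀ (by norm_num) (Nat.mul_le_mul_left C (Nat.mul_le_mul_left 2 hdT))
  have h2pos : (0 : ℝ) < (2 : ℝ) ^ (C * (2 * thm23Degree F₀ x)) := by positivity
  calc 1 / (2 : ℝ) ^ (C * (2 * (2 * T₀ + 1))) * (ε / thm23Degree F₀ x) ^ a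
      ≤ 1 / (2 : ℝ) ^ (C * (2 * thm23Degree F₀ x)) * ε ^ a :=
        mul_le_mul (one_div_le_one_div_of_le h2pos hpow) hεd (by positivity) (by positivity)
    _ = ε ^ a / (2 : ℝ) ^ (C * (2 * thm23Degree F₀ x)) := by ring

/-- **UNCONDITIONAL Aaronson–Ambainis promise-oracle simulation for bounded-query uniform families** (the `O(1)`-query
case of AA14 Thm. 26 in the tree's promise-transfer form, NO conjecture): for every uniform Clifford+T oracle family whose
circuits make at most `T₀` oracle queries and every polynomial `r`, there are a `PromiseBQP` problem `Q` and a polynomial-time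
classical transcript machine `C` such that, for every answer function `g` correct on `Q`'s promise and every input `x`,
`C` with the combined oracle `A ⊕ g` outputs the acceptance bit of `F₀^A` at `x` except on a set of oracles `A` of measure
`≤ 1/(r(|x|)+1)`.  (`pathBoundAt_of_boundedQueries` ∘ `oracleSimulationAt_of_pathBoundAt`.)
[cite: AaronsonAmbainis2014, Thm. 23 and Thm. 26] [cite: DinurEtAl2007, Thm. 3] -/
theorem oracleSimulationAt_of_boundedQueries (T₀ : ℕ) (F₀ : QCircuitFamily cliffordT)
    (hT : ∀ n, (F₀.circ n).oracleQueries ≤ T₀) :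
    F₀.IsUniform → ∀ r : Polynomial ℕ,
        ∃ Q ∈ Literature.Computability.Cryptography.PromiseBQP, ∃ (C : OracleAlg Bool) (q : Polynomial ℕ),
          C.IsPolyTime Computability.encodingBoolBool ∧
          (∀ (O : Oracle) (x : List Bool), ∀ y ∈ C.queries O (q.eval x.length) x, y.length ≤ q.eval x.length) ∧
          ∀ x : List Bool, 1 ≤ x.length → ∀ g : List Bool → Bool,
            (∀ v ∈ Q.yes, g v = true) → (∀ v ∈ Q.no, g v = false) →
            (ProbabilityTheory.setBernoulli (Set.univ : Set (List Bool)) ⟨1 / 2, by norm_num, by norm_num⟩)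
              {A : Set (List Bool) |
                (2 / 3 ≤ F₀.acceptProbOn A x ∧
                  C.run (Oracle.ofLanguage {w : List Bool | ∃ v : List Bool, (w = false :: v ∧ v ∈ A) ∨
                    (w = true :: v ∧ g v = true)}) (q.eval x.length) x ≠ some true) ∨
                (F₀.acceptProbOn A x ≤ 1 / 3 ∧
                  C.run (Oracle.ofLanguage {w : List Bool | ∃ v : List Bool, (w = false :: v ∧ v ∈ A) ∨
                    (w = true :: v ∧ g v = true)}) (q.eval x.length) x ≠ some false)}
              ≤ ENNReal.ofReal (1 / (((r.eval x.length : ℕ) : ℝ) + 1)) :=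
  oracleSimulationAt_of_pathBoundAt F₀ (pathBoundAt_of_boundedQueries T₀ F₀ hT)

end SimTreePB

end Summit.QuantumAdvantage.QuantumAdvantage.Cruxes.TransferPB.Birth

end
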